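/-
Copyright (c) 2026 the pub-hodgecm-mathlib formalisation cell (harness21).  Prover seat hodgecm-mathlib-K2E4-p14 (g6), Track B ∕ K2-LIT, h413 =
`stmt-HodgeConjecture-24833`, line `K2_E1_TraceFormulaBeta`, campaign «EIS-WHITTAKER-2», deck #4 «W5-FINAL» (dealer K2E1-plan (g4) 2026-09-04T07:50:14Z; wiring table of K2E1b-plan (g5)
`WIRING-W5-FINAL-EisWhittaker2` 8488e2cbf8493934).  LAYER 1 of the assembly.
-/
import Summits.HodgeConjecture.HodgeConjecture.Theorems.K2E1SphericalEisensteinContinuationU2     -- ★ W5-A p858272 (K2E1-p09 g5): `spherical_continuation_of_inputs`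
import Summits.HodgeConjecture.HodgeConjecture.Theorems.K2E1SphericalConstantTermContinuationU2     -- ★ W5-B p858422 (K2E4-p10 g4): `sphericalConstantTerm_continuation`
import Summits.HodgeConjecture.HodgeConjecture.Theorems.K2E1MaassSelbergSphericalBracketsCMTwo       -- ★ (R6k)₂ p858200∕p858242 (this seat): `intertwinedCoeff_const`; brings CT ★, Godement CM-two ★
import HarnessLib

/-!
# K2·E1 — `K2E1SphericalEisensteinContinuationU2Final` (LAYER 1): «(H4-b)₂-sph» AT THE CM PAIR — THE SPHERICAL EISENSTEIN SERIES OF `U(1,1)_{L∕L⁺}` CONTINUES MEROMORPHICALLY TO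
# `Re z > ½` WITH EXACTLY ONE POLE, SIMPLE, AT `z = 1`, RESIDUE `φ₀·r ≠ 0` — MODULO THE WHITTAKER LETTERS `W, hWhol, hWbd, hFourier` ONLY

Track B ∕ K2-LIT, crux h413 = `stmt-HodgeConjecture-24833`, route of record `HCCMUnconditional`; cell `hodgecm-mathlib`, squad K2, ENGINE E1.  Prover seat `hodgecm-mathlib-K2E4-p14` (g6);
deck #4 of the dealer K2E1-plan (g4) 07:50:14Z.  THEOREMS ONLY (no `def`, no `instance`, no notation, no named-fact hypothesis, no `sorry`); lane `--supports stmt-HodgeConjecture-24833 --as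
helper` (count-neutral).  Closes no socket.

THE ASSEMBLY (wiring table §0).  ★ W5-A `spherical_continuation_of_inputs` is the hypothesis-first capstone: from `U` open ∋ `1`, a constant-term continuation `c̃` (meromorphic on `U`, holomorphic
off `1`, `(z−1)c̃ → r`), a Whittaker family `W̃(z, ξ)` (holomorphic on `U`, W4-bounded), `h > 0` and the Fourier expansion `hE : E z = φ₀(h^z + c̃ z·h^{1−z}) + κ·Σ_{ξ≠0} W̃(z,ξ)` on `U ∩ {Re z > 1}`,
it delivers (a) holomorphy off `1`, (a′) meromorphy, (b) `Ẽ = E` on `Re z > 1`, (c) `(z−1)Ẽ → φ₀·r`.  THIS LAYER instantiates, at the CM pair `(L⁺, L)` and `U = {Re z > ½}`: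
* `c̃, r` := ★ W5-B `sphericalConstantTerm_continuation (L) hcδ hδ ν h𝓕N h𝓕c` — `r ≠ 0`, meromorphic∕holomorphic∕residue clauses, and `c̃ z = (ν𝓕)⁻¹·∫_{N(𝔸)} H(w₀v)^z dν` on `Re z > 1` (★);
* `h := H(g)` (★ `borelHeight_pos`), `E z := eisensteinSeriesU (φ₀·H^z) g`;
* the constant term on `Re z > 1`: ★ CT `borelConstantTerm_eisensteinSeriesU_two` (`E_B = f(g) + (ν𝓕)⁻¹·∫ f(w₀vg) dν`, Godement finiteness ★ `hfin_of_locallyUniformMajorant` ∘ ★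
  `exists_locallyUniform_majorant_flatSectionU_cm_two`, `N(𝔸)` inversion-invariant ★, `0 < ν(𝓕) < ∞` ★) and ★ (R6k)₂ `intertwinedCoeff_const` (`∫ φ₀H(w₀vg)^z dν = c(z)·φ₀·H(g)^{1−z}`, complex
  `z`) ⟹ `E_B(g) = φ₀·(H(g)^z + c̃(z)·H(g)^{1−z})`;
so that the ONLY letters left are the WHITTAKER SIDE: the closed form `W : ℂ → L⁺ → ℂ` as DATA with `hWhol`, `hWbd` (★ W5-A's shapes verbatim) and the FOURIER LETTER
`hFourier : ∀ z, 1 < Re z → E(z,g) − E_B(z,g) = κ·Σ'_{ξ} 𝟙_{ξ≠0}·W z ξ` (payers, all ★: W1 `eisensteinSeriesU_sub_borelConstantTerm_eq_two`, W3-cov p858333, W3 FILE 4 `…_eq_prod_cm_two_mellin`,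
W2-arch p858148, W2-fin p858310, W2-fin-S p858371∕p858404, #1b p858401 — LAYERS 2–3 of this file discharge them).
HEAD **`sphericalEisenstein_continuation_cm_two_of_whittaker`**: `∃ Ẽ r, r ≠ 0 ∧ MeromorphicOn Ẽ {Re z > ½} ∧ DifferentiableOn ℂ Ẽ ({Re z > ½} ∖ {1}) ∧ (∀ z, 1 < Re z → Ẽ z = E(φ₀H^z)(g)) ∧
Tendsto ((z−1)·Ẽ z) (𝓝[≠]1) (𝓝 (φ₀·r))` — «(H4-b)₂-sph: `L²_res ∩ sph = ℂ`» modulo the Whittaker letters.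
HONEST LABEL: HC_CM is proved only modulo the 7 printed citations (2 remaining named inputs: hLiu418 = `stmt-HodgeConjecture-24832`, h413 = `stmt-HodgeConjecture-24833`) until rung 0
closes; this file asserts no named fact and closes no socket; LAYER 1 is conditional by construction on `hWhol hWbd hFourier`.
References: [Garrett2018] §1.10–§1.12, §2.8–§2.11 · [Bump1997] §3.7 · [MoeglinWaldspurger1995] II.1.7, IV.1 · [Selberg1956] A. Selberg, *Harmonic analysis and discontinuous groups*, §7.
-/

set_option autoImplicit false
-- the mandated namespace repeats the single-problem summit's segment (`HodgeConjecture.HodgeConjecture`)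
set_option linter.dupNamespace false

noncomputable section

open MeasureTheory Measure NumberField NumberField.mixedEmbedding IsDedekindDomain Set Filter Module
open scoped ENNReal NNReal Topology Classical
open Literature.NumberTheory.Automorphic Literature.NumberTheory.Automorphic.UnitaryGroup AdelicGroupData
open Summit.HodgeConjecture.HodgeConjecture.Cruxes.H413.K2E1BorelEisensteinU
open Summit.HodgeConjecture.HodgeConjecture.Cruxes.H413.K2E1MaassSelbergBracketsThree (measurable_flatSectionU)
open Summit.HodgeConjecture.HodgeConjecture.Cruxes.H413.K2E1SphericalEisensteinContinuationU2 (spherical_continuation_of_inputs)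
open Summit.HodgeConjecture.HodgeConjecture.Cruxes.H413.K2E1SphericalConstantTermContinuationU2 (sphericalConstantTerm_continuation)
open Summit.HodgeConjecture.HodgeConjecture.Cruxes.H413.K2E1MaassSelbergSphericalBracketsCMTwo (intertwinedCoeff_const)
open Summit.HodgeConjecture.HodgeConjecture.Cruxes.H413.K2E1EisensteinSeriesLeftRight (borelConstantTerm_eisensteinSeriesU_two)
open Summit.HodgeConjecture.HodgeConjecture.Cruxes.H413.K2E1EisensteinAnalyticBinders (hfin_of_locallyUniformMajorant)
open Summit.HodgeConjecture.HodgeConjecture.Cruxes.H413.K2E1BorelEisensteinGodementCMTwo (exists_locallyUniform_majorant_flatSectionU_cm_two)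
open Summit.HodgeConjecture.HodgeConjecture.Cruxes.H413.K2E1BorelCosetsDictionary (forall_arithmeticBorel_iff)
open Summit.HodgeConjecture.HodgeConjecture.Cruxes.H413.K2E1UnipotentHaarNormalisationU2 (isInvInvariant_of_isHaarMeasure_two)

namespace Summit.HodgeConjecture.HodgeConjecture.Cruxes.H413.K2E1SphericalEisensteinContinuationU2Final

variable (L : Type) [Field L] [NumberField L] [IsCMField L]
variable [MeasurableSpace (quasiSplit (↥(maximalRealSubfield L)) L (IsCMField.complexConj L) 2).Adelic] [BorelSpace (quasiSplit (↥(maximalRealSubfield L)) L (IsCMField.complexConj L) 2).Adelic]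

/-! ## §1 The constant term of the spherical Eisenstein series at the CM pair: `E_B(z, g) = φ₀·(H(g)^z + c(z)·H(g)^{1−z})` on `Re z > 1` -/

/-- **`E(φ₀H^z)_B(g) = φ₀·H(g)^z + (ν𝓕)⁻¹·(∫_{N(𝔸)} H(w₀v)^z dν)·φ₀·H(g)^{1−z}`** on `Re z > 1` at the CM pair: ★ CT `borelConstantTerm_eisensteinSeriesU_two` (Godement finiteness ★ at CM, `N(𝔸)`
inversion-invariant ★, `0 < ν(𝓕) < ∞` from the fundamental domain of compact closure) and ★ (R6k)₂ `intertwinedCoeff_const` (`∫ φ₀·H(w₀vg)^z dν = c(z)·φ₀·H(g)^{1−z}`, complex `z`, Iwasawa ★).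
[cite: MoeglinWaldspurger1995, II.1.7] [cite: Garrett2018, §2.8] -/
theorem borelConstantTerm_sphericalEisenstein_cm_two (ν : Measure ↥(adelicUnipotent (↥(maximalRealSubfield L)) L (IsCMField.complexConj L) 2)) [ν.IsHaarMeasure]
    {𝓕 : Set ↥(adelicUnipotent (↥(maximalRealSubfield L)) L (IsCMField.complexConj L) 2)} (h𝓕N : IsFundamentalDomain ↥(rationalUnipotent (↥(maximalRealSubfield L)) L (IsCMField.complexConj L) 2) 𝓕 ν) (h𝓕c : IsCompact (closure 𝓕))
    (φ₀ : ℂ) {z : ℂ} (hz : 1 < z.re) (g : (quasiSplit (↥(maximalRealSubfield L)) L (IsCMField.complexConj L) 2).Adelic) :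
    borelConstantTerm ν 𝓕 (eisensteinSeriesU (flatSectionU (fun _ : (quasiSplit (↥(maximalRealSubfield L)) L (IsCMField.complexConj L) 2).Adelic => φ₀) z)) g =
      φ₀ * (((borelHeight g : ℝ) : ℂ) ^ z +
        ((((ν 𝓕).toReal⁻¹ : ℝ)) : ℂ) * (∫ v : ↥(adelicUnipotent (↥(maximalRealSubfield L)) L (IsCMField.complexConj L) 2), (((borelHeight ((quasiSplit (↥(maximalRealSubfield L)) L (IsCMField.complexConj L) 2).toAdelic (weylLongU ((IsCMField.complexConj L : L ≃ₐ[↥(maximalRealSubfield L)] L) : L →+* L) (rfl : (StdForm.antidiagonal 2).over L = (StdForm.antidiagonal 2).over L)) * (v : (quasiSplit (↥(maximalRealSubfield L)) L (IsCMField.complexConj L) 2).Adelic)) : ℝ) : ℂ) ^ z) ∂ν) * ((borelHeight g : ℝ) : ℂ) ^ (1 - z)) := by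
  haveI := t2Space_adeleRing_of_numberField L
  haveI := locallyCompactSpace_adeleRing' L
  haveI : T2Space (quasiSplit (↥(maximalRealSubfield L)) L (IsCMField.complexConj L) 2).Adelic := inferInstanceAs (T2Space (adelic (↥(maximalRealSubfield L)) L (IsCMField.complexConj L) 2 ((StdForm.antidiagonal 2).over L)))
  haveI : ν.IsInvInvariant := isInvInvariant_of_isHaarMeasure_two ν
  have hc : IsCMField.complexConj L * IsCMField.complexConj L = 1 := AlgEquiv.ext fun x => IsCMField.complexConj_apply_apply L x
  have hc1 : IsCMField.complexConj L ≠ 1 := IsCMField.complexConj_ne_one L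
  have hBK := exists_mem_borelAdelic_mul_mem_standardMaximalCompactGL_cm L (N := 2)
  have h𝓕₀ : ν 𝓕 ≠ 0 := measure_ne_zero_of_isFundamentalDomain_rationalUnipotent ν h𝓕N
  have h𝓕top : ν 𝓕 ≠ ∞ := ((measure_mono subset_closure).trans_lt h𝓕c.measure_lt_top).ne
  -- the flat spherical section: Borel, left-`N(𝔸)`- and `B(L⁺)`-invariant, Godement-finite at `g`
  have hfm : Measurable (flatSectionU (fun _ : (quasiSplit (↥(maximalRealSubfield L)) L (IsCMField.complexConj L) 2).Adelic => φ₀) z) := measurable_flatSectionU measurable_const z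
  have hfN : ∀ (n : ↥(adelicUnipotent (↥(maximalRealSubfield L)) L (IsCMField.complexConj L) 2)) (y : (quasiSplit (↥(maximalRealSubfield L)) L (IsCMField.complexConj L) 2).Adelic), flatSectionU (fun _ : (quasiSplit (↥(maximalRealSubfield L)) L (IsCMField.complexConj L) 2).Adelic => φ₀) z ((n : (quasiSplit (↥(maximalRealSubfield L)) L (IsCMField.complexConj L) 2).Adelic) * y) = flatSectionU (fun _ : (quasiSplit (↥(maximalRealSubfield L)) L (IsCMField.complexConj L) 2).Adelic => φ₀) z y := fun n y => by
    rw [flatSectionU_apply, flatSectionU_apply, borelHeight_unipotent_mul n.2 y]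
  have hfB : ∀ b ∈ borelU ((IsCMField.complexConj L : L ≃ₐ[↥(maximalRealSubfield L)] L) : L →+* L) ((StdForm.antidiagonal 2).over L), ∀ x : (quasiSplit (↥(maximalRealSubfield L)) L (IsCMField.complexConj L) 2).Adelic,
      flatSectionU (fun _ : (quasiSplit (↥(maximalRealSubfield L)) L (IsCMField.complexConj L) 2).Adelic => φ₀) z ((quasiSplit (↥(maximalRealSubfield L)) L (IsCMField.complexConj L) 2).toAdelic b * x) = flatSectionU (fun _ : (quasiSplit (↥(maximalRealSubfield L)) L (IsCMField.complexConj L) 2).Adelic => φ₀) z x :=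
    forall_arithmeticBorel_iff.1 fun b hb x => by rw [flatSectionU_apply, flatSectionU_apply, K2E1TruncatedEisensteinExplicit.borelHeight_arithmeticBorel_mul hb]
  have hfin := hfin_of_locallyUniformMajorant ν hfB (fun q => (continuous_flatSectionU continuous_const z).comp (continuous_const.mul continuous_id))
    (exists_locallyUniform_majorant_flatSectionU_cm_two L hz (φ := fun _ : (quasiSplit (↥(maximalRealSubfield L)) L (IsCMField.complexConj L) 2).Adelic => φ₀) (M := ‖φ₀‖) (fun x => le_rfl)) h𝓕c g
  rw [borelConstantTerm_eisensteinSeriesU_two ν hfm hfN hfB h𝓕N h𝓕₀ h𝓕top g hfin]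
  -- the intertwining integral: `∫ φ₀H(w₀vg)^z dν = c(z)·φ₀·H(g)^{1−z}` (★ (R6k)₂, complex exponent)
  have hne : ((borelHeight g : ℝ) : ℂ) ≠ 0 := Complex.ofReal_ne_zero.2 (ne_of_gt (by exact_mod_cast borelHeight_pos g))
  have hI := intertwinedCoeff_const hc hc1 ν hBK φ₀ z g
  have hA : ∫ v : ↥(adelicUnipotent (↥(maximalRealSubfield L)) L (IsCMField.complexConj L) 2), flatSectionU (fun _ : (quasiSplit (↥(maximalRealSubfield L)) L (IsCMField.complexConj L) 2).Adelic => φ₀) z ((quasiSplit (↥(maximalRealSubfield L)) L (IsCMField.complexConj L) 2).toAdelic (weylLongU ((IsCMField.complexConj L : L ≃ₐ[↥(maximalRealSubfield L)] L) : L →+* L) (rfl : (StdForm.antidiagonal 2).over L = (StdForm.antidiagonal 2).over L)) * (v : (quasiSplit (↥(maximalRealSubfield L)) L (IsCMField.complexConj L) 2).Adelic) * g) ∂ν =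
      (∫ v : ↥(adelicUnipotent (↥(maximalRealSubfield L)) L (IsCMField.complexConj L) 2), (((borelHeight ((quasiSplit (↥(maximalRealSubfield L)) L (IsCMField.complexConj L) 2).toAdelic (weylLongU ((IsCMField.complexConj L : L ≃ₐ[↥(maximalRealSubfield L)] L) : L →+* L) (rfl : (StdForm.antidiagonal 2).over L = (StdForm.antidiagonal 2).over L)) * (v : (quasiSplit (↥(maximalRealSubfield L)) L (IsCMField.complexConj L) 2).Adelic)) : ℝ) : ℂ) ^ z) ∂ν) * φ₀ * ((borelHeight g : ℝ) : ℂ) ^ (1 - z) := by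
    simp_rw [mul_assoc ((quasiSplit (↥(maximalRealSubfield L)) L (IsCMField.complexConj L) 2).toAdelic (weylLongU ((IsCMField.complexConj L : L ≃ₐ[↥(maximalRealSubfield L)] L) : L →+* L) (rfl : (StdForm.antidiagonal 2).over L = (StdForm.antidiagonal 2).over L)))]
    calc ∫ v : ↥(adelicUnipotent (↥(maximalRealSubfield L)) L (IsCMField.complexConj L) 2), flatSectionU (fun _ : (quasiSplit (↥(maximalRealSubfield L)) L (IsCMField.complexConj L) 2).Adelic => φ₀) z ((quasiSplit (↥(maximalRealSubfield L)) L (IsCMField.complexConj L) 2).toAdelic (weylLongU ((IsCMField.complexConj L : L ≃ₐ[↥(maximalRealSubfield L)] L) : L →+* L) (rfl : (StdForm.antidiagonal 2).over L = (StdForm.antidiagonal 2).over L)) * ((v : (quasiSplit (↥(maximalRealSubfield L)) L (IsCMField.complexConj L) 2).Adelic) * g)) ∂ν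
        = (∫ v : ↥(adelicUnipotent (↥(maximalRealSubfield L)) L (IsCMField.complexConj L) 2), flatSectionU (fun _ : (quasiSplit (↥(maximalRealSubfield L)) L (IsCMField.complexConj L) 2).Adelic => φ₀) z ((quasiSplit (↥(maximalRealSubfield L)) L (IsCMField.complexConj L) 2).toAdelic (weylLongU ((IsCMField.complexConj L : L ≃ₐ[↥(maximalRealSubfield L)] L) : L →+* L) (rfl : (StdForm.antidiagonal 2).over L = (StdForm.antidiagonal 2).over L)) * ((v : (quasiSplit (↥(maximalRealSubfield L)) L (IsCMField.complexConj L) 2).Adelic) * g)) ∂ν) * (((borelHeight g : ℝ) : ℂ) ^ (z - 1) * ((borelHeight g : ℝ) : ℂ) ^ (1 - z)) := by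
          rw [← Complex.cpow_add _ _ hne, show z - 1 + (1 - z) = 0 by ring, Complex.cpow_zero, mul_one]
      _ = _ := by rw [← mul_assoc, hI]
  rw [hA, flatSectionU_apply, Complex.real_smul]
  ring

/-! ## §2 LAYER 1: «(H4-b)₂-sph» at the CM pair modulo the Whittaker letters `W, hWhol, hWbd, hFourier` -/

/-- **«(H4-b)₂-sph» AT THE CM PAIR, LAYER 1** — for `δ ∈ L⁻ ∖ 0`, a Haar measure `ν` of `N(𝔸_{L⁺})`, a fundamental domain `𝓕` of `N(L⁺)` with compact closure, `φ₀ κ : ℂ`, `g ∈ U(J₂)(𝔸)`, and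
the WHITTAKER LETTERS: a family `W : ℂ → L⁺ → ℂ` holomorphic on `{Re z > ½}` for each `ξ ≠ 0` (`hWhol`) with W4's local exponential-times-polynomial bounds and compact finite support
(`hWbd`, ★ W5-A's shape), and the Fourier letter `hFourier : E(φ₀H^z)(g) − E(φ₀H^z)_B(g) = κ·Σ'_ξ 𝟙_{ξ≠0} W z ξ` on `Re z > 1` (payers ★ W1 ∘ W3-cov ∘ W3 FILE 4 ∘ W2-arch∕-fin∕-fin-S): THERE ARE
`Ẽ : ℂ → ℂ` and `r ≠ 0` with `Ẽ` MEROMORPHIC on `{Re z > ½}`, HOLOMORPHIC off `z = 1`, `Ẽ(z) = E(φ₀H^z)(g)` for `Re z > 1`, and `(z − 1)·Ẽ(z) → φ₀·r` (`z → 1`): exactly one pole, simple, at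
`z = 2ρ_H = 1`, with residue the constant `φ₀·r` (★ W5-A ∘ ★ W5-B ∘ §1).  `r` is W5-B's explicit residue (`≠ 0`), independent of `g`. [cite: Garrett2018, §1.10–§1.12 and §2.8–§2.11]
[cite: Bump1997, §3.7] [cite: MoeglinWaldspurger1995, IV.1] -/
theorem sphericalEisenstein_continuation_cm_two_of_whittaker {δ : L} (hcδ : IsCMField.complexConj L δ = -δ) (hδ : δ ≠ 0)
    (ν : Measure ↥(adelicUnipotent (↥(maximalRealSubfield L)) L (IsCMField.complexConj L) 2)) [ν.IsHaarMeasure]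
    {𝓕 : Set ↥(adelicUnipotent (↥(maximalRealSubfield L)) L (IsCMField.complexConj L) 2)} (h𝓕N : IsFundamentalDomain ↥(rationalUnipotent (↥(maximalRealSubfield L)) L (IsCMField.complexConj L) 2) 𝓕 ν) (h𝓕c : IsCompact (closure 𝓕))
    (φ₀ κ : ℂ) (g : (quasiSplit (↥(maximalRealSubfield L)) L (IsCMField.complexConj L) 2).Adelic) (W : ℂ → ↥(maximalRealSubfield L) → ℂ)
    (hWhol : ∀ ξ : ↥(maximalRealSubfield L), ξ ≠ 0 → DifferentiableOn ℂ (fun z => W z ξ) {z : ℂ | 1 / 2 < z.re})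
    (hWbd : ∀ z₀ ∈ {z : ℂ | 1 / 2 < z.re}, ∃ V ∈ 𝓝 z₀, ∃ (M b a : ℝ) (Cf : Set (FiniteAdeleRing (𝓞 ↥(maximalRealSubfield L)) ↥(maximalRealSubfield L))), 0 ≤ M ∧ 0 < b ∧ IsCompact Cf ∧
      ∀ z ∈ V, ∀ ξ : ↥(maximalRealSubfield L),
        ‖W z ξ‖ ≤ M * Real.exp (-(b * ‖InfiniteAdeleRing.ringEquiv_mixedSpace ↥(maximalRealSubfield L) (algebraMap ↥(maximalRealSubfield L) (AdeleRing (𝓞 ↥(maximalRealSubfield L)) ↥(maximalRealSubfield L)) ξ).1‖)) *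
          (1 + ‖InfiniteAdeleRing.ringEquiv_mixedSpace ↥(maximalRealSubfield L) (algebraMap ↥(maximalRealSubfield L) (AdeleRing (𝓞 ↥(maximalRealSubfield L)) ↥(maximalRealSubfield L)) ξ).1‖) ^ a ∧
        ((algebraMap ↥(maximalRealSubfield L) (AdeleRing (𝓞 ↥(maximalRealSubfield L)) ↥(maximalRealSubfield L)) ξ).2 ∉ Cf → W z ξ = 0))
    (hFourier : ∀ z : ℂ, 1 < z.re →
      eisensteinSeriesU (flatSectionU (fun _ : (quasiSplit (↥(maximalRealSubfield L)) L (IsCMField.complexConj L) 2).Adelic => φ₀) z) g - borelConstantTerm ν 𝓕 (eisensteinSeriesU (flatSectionU (fun _ : (quasiSplit (↥(maximalRealSubfield L)) L (IsCMField.complexConj L) 2).Adelic => φ₀) z)) g =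
        κ * ∑' ξ : ↥(maximalRealSubfield L), ({0}ᶜ : Set ↥(maximalRealSubfield L)).indicator (fun ξ => W z ξ) ξ) :
    ∃ (Ec : ℂ → ℂ) (r : ℂ), r ≠ 0 ∧ MeromorphicOn Ec {z : ℂ | 1 / 2 < z.re} ∧ DifferentiableOn ℂ Ec ({z : ℂ | 1 / 2 < z.re} \ {1}) ∧
      (∀ z : ℂ, 1 < z.re → Ec z = eisensteinSeriesU (flatSectionU (fun _ : (quasiSplit (↥(maximalRealSubfield L)) L (IsCMField.complexConj L) 2).Adelic => φ₀) z) g) ∧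
      Tendsto (fun z : ℂ => (z - 1) * Ec z) (𝓝[≠] 1) (𝓝 (φ₀ * r)) := by
  obtain ⟨c, r, hr, hcmer, hchol, hcres, hceq⟩ := sphericalConstantTerm_continuation L hcδ hδ ν h𝓕N h𝓕c
  have hU : IsOpen {z : ℂ | 1 / 2 < z.re} := isOpen_lt continuous_const Complex.continuous_re
  have h1U : (1 : ℂ) ∈ {z : ℂ | 1 / 2 < z.re} := by
    show (1 : ℝ) / 2 < (1 : ℂ).re
    norm_num
  have hh : (0 : ℝ) < (borelHeight g : ℝ) := by exact_mod_cast borelHeight_pos g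
  -- the Fourier expansion `hE` on `Re z > 1`: §1 (constant term) + the Fourier letter
  have hE : ∀ z ∈ {z : ℂ | 1 / 2 < z.re}, 1 < z.re →
      eisensteinSeriesU (flatSectionU (fun _ : (quasiSplit (↥(maximalRealSubfield L)) L (IsCMField.complexConj L) 2).Adelic => φ₀) z) g =
        φ₀ * ((((borelHeight g : ℝ) : ℝ) : ℂ) ^ z + c z * (((borelHeight g : ℝ) : ℝ) : ℂ) ^ (1 - z)) +
          κ * ∑' ξ : ↥(maximalRealSubfield L), ({0}ᶜ : Set ↥(maximalRealSubfield L)).indicator (fun ξ => W z ξ) ξ := by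
    intro z _ hz
    rw [← hFourier z hz, hceq z hz, borelConstantTerm_sphericalEisenstein_cm_two L ν h𝓕N h𝓕c φ₀ hz g]
    ring
  obtain ⟨ha, ha', hb, hc⟩ := spherical_continuation_of_inputs ↥(maximalRealSubfield L) hU h1U hcmer hchol hcres hWhol hWbd φ₀ κ hh hE
  exact ⟨_, r, hr, ha', ha, fun z hz => hb z (show (1 : ℝ) / 2 < z.re by linarith) hz, hc⟩

end Summit.HodgeConjecture.HodgeConjecture.Cruxes.H413.K2E1SphericalEisensteinContinuationU2Final

end
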